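import Mathlib.Tactic.Linarith
import Mathlib.Tactic.NormNum
import Mathlib.Tactic.Ring
import HarnessLib

/-!
# The (0,1) cell of the ι-window, XXXII-B: the product ground `B₁ × B₂`, XIX (ADDENDUM 1) — THE CORNER III, (R-rib-EZ): THEOREM EZ-VOID
# (report [XXXII] `H2-ZERO-ONE-32.md` §12): arithmetic shadows

Family `hodge`, b2b cell `hweil` (helper of item stmt-HodgeConjecture-2524). Companion (`pg19a_*`) of `WeilTypeLadderH2ProductGroundNineteen.lean`
(same seat). Report `run/shared/lean/b2b/hodge-weil/b2b-hweil-pv1-g44/H2-ZERO-ONE-32.md` ([XXXII]) §12 (ADDENDUM 1): the (EZ, red-bundle) rows of the corner —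
V-half `𝓘_{E∪Z}𝓛′ + v` (cosupport divisor `E`, pieces `G[x] = (d₁,n₁)`, `Ḡ = 𝓘_Z·(d₂,n₂)`, `d₁ + d₂ = 4`, `σ = n₁ + n₂`, `δ = e₂ = n₁ − n₂`, `Z` a configuration of `a`
vertical and `b` horizontal rigid product curves with δ-invariant `δ_Z`), H-half a rank-2 bundle with `m′ = n′² + A − a`, `μ′ = 3n′ + B − b` (the pairing of [XXXII] §2):
the class equation, the index rule at half-periods, and the dimension table of THEOREM EZ-VOID (no (0,1) object unless `e₂ = 0`, or `(d₁,e₂) = (1,2)` off `S`).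
HONEST FRAMING: census results inside the ladder's H2 test ((0,1) cell) on the SPECIAL fourfold `X₀ = B₁ × B₂`; nothing here is a rung; no case of the Hodge
conjecture is proved; no statement of [Markman 2025] / [Perry 2026] / [EdGFS 2025] is used. Every theorem is a def-free arithmetic statement that the report cites at
the step named in its docstring; none claims geometry.
-/

-- mandated namespace `Summit.HodgeConjecture.HodgeConjecture.…` (Problem = Summit) trips `linter.dupNamespace`; the lakefile disables it
-- tree-wide (weak option), restated here so stand-alone elaboration is warning-free too.
set_option linter.dupNamespace false

namespace Summit.HodgeConjecture.HodgeConjecture.WeilTypeLadder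

section ProductGroundNineteenAdd1

/-- **[XXXII] 12.3 (iii) (the (EZ, red-bundle) class equation).** With `d₂ = 4 − d₁`, `n′ = 2 − n₁ − n₂`, `A = n₁(d₁−1) + n₂(d₂−1)`, `B = n₁² + n₂²`,
`C = n₁²(d₁−1) + n₂²(d₂−1)`, `m′ = n′² + A − a`, `μ′ = 3n′ + B − b` and the top-degree term `a(2n₂−1) + b(d₂−1) − δ_Z` of `ch(𝒪_Z ⊗ L₂)` ([XXXI] 2.3), twice the
top-degree equation `C − (a(2n₂−1) + b(d₂−1) − δ_Z) + 3n′² − n′μ′ − m′ + 2 = 0` reads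
**`(σ−1)((σ−1)² + δ² + 3 + 2(d₁−2)δ) + 4a(1−n₂) + 2b(d₁−1−σ) + 2δ_Z = 0`** (`σ = n₁+n₂`, `δ = n₁−n₂`); (ii) its specialisation `δ = 0` (the residual
(R-rib-EZ₀), `σ = 2n`): `(2n−1)((2n−1)² + 3) + 2a(2−2n) + 2b(d₁−1−2n) + 2δ_Z`; (iii) its specialisation `d₁ = 1`, `δ = 2` (the residual (R-rib-EZ₁), `σ = 2n−2`):
`(2n−3)((2n−3)² + 3) + 2a(4−(2n−2)) − 2b(2n−2) + 2δ_Z`. [`ring`] -/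
theorem pg19a_EZ_class_equation :
    (∀ d₁ n₁ n₂ a b δZ : ℤ,
      2 * ((n₁ ^ 2 * (d₁ - 1) + n₂ ^ 2 * ((4 - d₁) - 1)) - (a * (2 * n₂ - 1) + b * ((4 - d₁) - 1) - δZ)
            + 3 * (2 - n₁ - n₂) ^ 2
            - (2 - n₁ - n₂) * (3 * (2 - n₁ - n₂) + (n₁ ^ 2 + n₂ ^ 2) - b)
            - ((2 - n₁ - n₂) ^ 2 + (n₁ * (d₁ - 1) + n₂ * ((4 - d₁) - 1)) - a) + 2)
        = ((n₁ + n₂) - 1) * (((n₁ + n₂) - 1) ^ 2 + (n₁ - n₂) ^ 2 + 3 + 2 * (d₁ - 2) * (n₁ - n₂))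
          + 4 * a * (1 - n₂) + 2 * b * (d₁ - 1 - (n₁ + n₂)) + 2 * δZ) ∧
    (∀ d₁ n a b δZ : ℤ,
      ((n + n) - 1) * (((n + n) - 1) ^ 2 + (n - n) ^ 2 + 3 + 2 * (d₁ - 2) * (n - n))
          + 4 * a * (1 - n) + 2 * b * (d₁ - 1 - (n + n)) + 2 * δZ
        = (2 * n - 1) * ((2 * n - 1) ^ 2 + 3) + 2 * a * (2 - 2 * n) + 2 * b * (d₁ - 1 - 2 * n) + 2 * δZ) ∧
    (∀ n a b δZ : ℤ,
      ((n + (n - 2)) - 1) * (((n + (n - 2)) - 1) ^ 2 + (n - (n - 2)) ^ 2 + 3 + 2 * ((1:ℤ) - 2) * (n - (n - 2)))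
          + 4 * a * (1 - (n - 2)) + 2 * b * ((1:ℤ) - 1 - (n + (n - 2))) + 2 * δZ
        = (2 * n - 3) * ((2 * n - 3) ^ 2 + 3) + 2 * a * (4 - (2 * n - 2)) - 2 * b * (2 * n - 2) + 2 * δZ) := by
  refine ⟨fun d₁ n₁ n₂ a b δZ => by ring, fun d₁ n a b δZ => by ring, fun n a b δZ => by ring⟩

/-- **[XXXII] 12.3 (i)–(ii) (the index rule of 𝓘_{E∪Z}𝓛′ at a half-period and its balance consequences).** `t_p(G) = c₂(p)·(2 − 2π − t)` with `π = ±1` the parity of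
`E`'s local equation and `t = t_p(𝒪_Z) ∈ {0, 8, −8}` (LEMMA PAR). Off `S` (partner absent) balance needs `2 − 2π − t = 0`, i.e. **`π = +1` and `t = 0`**; on `S[2]`
(partner locally free, `|t_p(Q)| ≤ 4`) it needs `2 − 2π − t ∈ {0, ±4}`, i.e. **`(π, t) ∈ {(1,0), (−1,0), (−1,8)}`** — for `π = −1` (odd `e₂`) the value `t = −8`
(a horizontal and an even number ≥ 2 of verticals through `p`) is excluded. [case split; `omega`] -/
theorem pg19a_index_rule :
    ∀ π t : ℤ, (π = 1 ∨ π = -1) → (t = 0 ∨ t = 8 ∨ t = -8) →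
      ((2 - 2 * π - t = 0 ↔ (π = 1 ∧ t = 0)) ∧
       ((2 - 2 * π - t = 0 ∨ 2 - 2 * π - t = 4 ∨ 2 - 2 * π - t = -4) ↔
          ((π = 1 ∧ t = 0) ∨ (π = -1 ∧ t = 0) ∨ (π = -1 ∧ t = 8)))) := by
  intro π t hπ ht
  rcases hπ with rfl | rfl <;> rcases ht with rfl | rfl | rfl <;> omega

/-- **[XXXII] 12.4 (the eigen-dimensions behind `A(E)`).** For `m ≥ 1`: `H⁰(B₂, 2mΘ₀)` has even part `2m² + 2 ≥ 4` and odd part `2m² − 2 ≥ 0`; `H⁰(B₂, (2m+1)Θ_{κ₂})`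
(odd level `k = 2m+1`, `k² = (2m+1)²` sections) splits under `(−1)` into parts of dimensions `(k² ± 1)/2`, both `≥ (k² − 1)/2 = 2m² + 2m ≥ 4`; hence for
`e₂ ≥ 3` the `x`-part of `A(E)` alone has dimension `≥ 4d₁` (`d₁ ≥ 1`). [`nlinarith` / `ring`] -/
theorem pg19a_theta_dims :
    (∀ m : ℤ, 1 ≤ m → 4 ≤ 2 * m ^ 2 + 2 ∧ 0 ≤ 2 * m ^ 2 - 2) ∧
    (∀ m : ℤ, (2 * m + 1) ^ 2 - 1 = 2 * (2 * m ^ 2 + 2 * m) ∧ (2 * m + 1) ^ 2 + 1 = 2 * (2 * m ^ 2 + 2 * m + 1)) ∧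
    (∀ m : ℤ, 1 ≤ m → 4 ≤ 2 * m ^ 2 + 2 * m) ∧
    (∀ d₁ m : ℤ, 1 ≤ d₁ → 1 ≤ m → 4 * d₁ ≤ d₁ * (2 * m ^ 2 + 2) ∧ 4 * d₁ ≤ d₁ * (2 * m ^ 2 + 2 * m)) := by
  refine ⟨fun m hm => ⟨by nlinarith, by nlinarith⟩, fun m => ⟨by ring, by ring⟩, fun m hm => by nlinarith, fun d₁ m hd hm => ?_⟩
  have h1 : 4 ≤ 2 * m ^ 2 + 2 := by nlinarith
  have h2 : 4 ≤ 2 * m ^ 2 + 2 * m := by nlinarith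
  exact ⟨by nlinarith, by nlinarith⟩

/-- **[XXXII] 12.4 THEOREM EZ-VOID (the table of lower bounds).** `dim A(E) = 0, d₁, d₁, ≥ 4d₁` for `e₂ = 0, 1, 2, ≥ 3`; the ribbon-twist orbit when `E ⊇ S` has
dimension `h(d₁) := h⁰(K^{3−d₁}) = 3, 2, 1, 0` for `d₁ = 1, 2, 3, ≥ 4` (LEMMA STAB); the bounds: `e₂ = 1` (and `e₂ = 2` with `E ⊇ S`): `(d₁ − 1) + h(d₁) ≥ 3`;
`e₂ = 2`, `E ⊉ S`: `d₁`, which is `≥ 2` iff `d₁ ≥ 2` — the exception `(d₁,e₂) = (1,2)` has bound `1`; `e₂ ≥ 3`: `4d₁ − 1 ≥ 3`. So outside `e₂ = 0` and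
`(d₁,e₂) = (1,2)` off `S` every bound is `≥ 2` (indeed `≥ 3` except `e₂ = 2`, `E ⊉ S`, `d₁ = 2`). [`norm_num` / `omega`] -/
theorem pg19a_EZ_table :
    ((0:ℤ) + 3 = 3 ∧ (1:ℤ) + 2 = 3 ∧ (2:ℤ) + 1 = 3 ∧ (∀ d₁ : ℤ, 4 ≤ d₁ → 3 ≤ (d₁ - 1) + 0)) ∧
    (∀ d₁ : ℤ, 1 ≤ d₁ → (2 ≤ d₁ ↔ d₁ ≠ 1)) ∧ ((1:ℤ) < 2) ∧
    (∀ d₁ : ℤ, 1 ≤ d₁ → 3 ≤ 4 * d₁ - 1) ∧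
    (∀ d₁ e₂ : ℤ, 1 ≤ d₁ → 1 ≤ e₂ → ¬ (d₁ = 1 ∧ e₂ = 2) → (e₂ = 1 ∨ e₂ = 2 ∨ 3 ≤ e₂) ∧ (e₂ = 2 → 2 ≤ d₁)) := by
  refine ⟨⟨by norm_num, by norm_num, by norm_num, fun d₁ h => by omega⟩, fun d₁ h => by omega, by norm_num, fun d₁ h => by omega,
    fun d₁ e₂ hd he hne => ⟨by omega, fun h2 => by omega⟩⟩

end ProductGroundNineteenAdd1

end Summit.HodgeConjecture.HodgeConjecture.WeilTypeLadder
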